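import Summits.QuantumFields.YangMills.Theorems.BalabanUVNodesN15CovariantAveragingDefectKernel
import Summits.QuantumFields.YangMills.Theorems.BalabanUVNodesN15CovariantAveragingLetterLocal
import HarnessLib

/-!
# N15 = NE2, road (c) — PROGRAMME (PC), towards (PC-E): THE TWO-GRID η-DEFECT ROW OF `N_V^Q` BEHIND THE CUTS FROM BOX-LOCAL DATA — n15-c∕`cv_hasMaj_idef_sandwich_cvNVq` with the
# transporter letters AND the holonomy fit asked only one coarse step around `supp χ` (kernel extension; same constant, same `Φ`) (dag-n15-c g30, n15-c∕326)

Cell `pub-ymgap`, seat `pub-ymgap-dag-n15-c` (generation g30; R134 (a), s1; HUMAN RULING D-0062).  `bears_on: R4∕N15 · K3⁸ SpineGivenEndpointR13SepCoPHV (stmt-QuantumFields-27366)`;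
filed `--kind proof --supports stmt-QuantumFields-27366 --as helper` — COUNT-NEUTRAL.  Theorems only, 0 `def`, 0 `sorry`; bookkeeping, no estimate of Bałaban's.  Imports BY NAME n15-c∕325
`…CovariantAveragingDefectKernel` (`CovAvg.hasMaj_idef_nvKer`), n15-c∕317 `…CovariantAveragingLetterLocal` (`CovAvg.cvaPath_congr_of_blockOf`, `qvKer_mulOp_apply_eq_zero`; through it
n15-c∕`…CovariantAveragingDefectRows` for `idef_sandwich_pull`, `hasMaj_sandwich₂_of_abs_le_one`, `liftBlk_blockOf_fine_eq`, `rows∕cols_cvaPath_conj_sub_le`, `blockOf_kingPr`,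
`kingPr_sub_mul_smul`).  Nothing in the tree is modified.

WHY (HOME HANDOFF §g30: the (PC-E) brick that does not wait for the pairing decision).  The two-grid knit n15-c∕123∕127 displays the η-defect rows `hDNV`∕`hDfarN` of the perturbation;
n15-c∕`cv_hasMaj_idef_sandwich_cvNVq` delivers them for `N_V^Q` from GLOBAL transporter letters and a GLOBAL holonomy fit `Φ`.  In the per-cube class the letters hold only on the cube's
box.  Extending the FIELDS by `𝟙` (n15-c∕317's device) would break the fit on paths crossing the extension boundary; THIS FILE extends the PATH KERNELS instead: `W̃ := cvaPath T` on the
paths whose two unit blocks `B(x), B(x)+e_κ` lie in the data region `E`, `:= 1` elsewhere — the SAME criterion for a fine path from `x′` and its coarse partner from `πx′` (`B′(x′) = B(πx′)`,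
`blockOf_kingPr`), so the kernel fit is the local fit inside and `0` outside, the row bounds hold (`1 ≤ 1 + K`), and behind the cuts the words are unchanged (§1).  n15-c∕325 then gives the
row with the SAME constant and the SAME `Φ`.

WHAT.  §1 (namespace `CovAvg`, any spacing) `qvKer_comp_mulOp_congr_of_blocks`, `qvAdjKer_apply_congr_of_blocks`, ★ `adjKer_comp_ker_comp_mulOp_congr_of_blocks`.  §2 ★★★
`cv_hasMaj_idef_sandwich_cvNVq_local`: n15-c∕`cv_hasMaj_idef_sandwich_cvNVq`'s statement with (i) `S ⊇ B(supp χ)`, `S ∪ (S ± e_κ) ⊆ E` stepwise, (ii) the transporter letters `ρ` (coarse,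
rows and columns) and `ρ₁` (fine, columns) asked only at bond points whose unit block lies in `E`, (iii) the holonomy fit `Φ` asked only for paths whose start block and its `μ`-neighbour lie
in `E`; unitarity of `U, U′` global (as in the application); conclusion IDENTICAL (same majorant, from coarse coloured bonds into fine ones read through `π̂`).

HONEST FRAMING ∕ LIMITS.  Bookkeeping on MODEL carriers (doubled-torus cover, `Q(U)` = main term (125), one-level staircases, King's pairing `π`); the fit `Φ` is a DISPLAYED pairing datum
(the lane's model pairing; the print's `U = Ū(U′)` is not modelled); [B9] (3.26) p.395, (3.76)–(3.77) p.406, Cor. 3.8 p.410 and [King1986] (2.1) p.664 cited for SHAPES ∕ MECHANISM only.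
NE2⁺ NOT PRINTED, NOT proved; N15 of record untouched (DISCHARGED AS CONSUMED, p687738); K3⁸ OPEN; counts UNMOVED (typed 28∕28); one finite 𝕋⁴ at fixed ε per index — NOT infinite volume,
NOT OS on ℝ⁴, NOT a mass gap, NOT Clay.  Restate-immune (no Theses import).
-/

noncomputable section

open scoped BigOperators Matrix
open Finset

namespace Summit.QuantumFields.YangMills.BalabanUVNodes.N15.CovAvg

open Literature.MathematicalPhysics.QuantumFieldTheory.Balaban1983to89
open Literature.MathematicalPhysics.QuantumFieldTheory.Balaban1983to89.B5Prop11Plancherel (Tor fine unitVec)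
open Literature.MathematicalPhysics.QuantumFieldTheory.Balaban1983to89.B6Prop26Gluing (mulOp mulOp_apply)
open Literature.MathematicalPhysics.QuantumFieldTheory.Balaban1983to89.T4EtaRateCoeffDefect (fibre mem_fibre)
open Literature.MathematicalPhysics.QuantumFieldTheory.King1986.Torus (blockOf)

variable {d : ℕ}

/-! ## §1 Kernel-level locality behind a cut -/

section Kernels

variable (M : Fin (d + 1) → ℕ) [∀ μ, NeZero (M μ)] (n : ℕ) [NeZero n] {ι : Type} [Fintype ι] [DecidableEq ι]

omit [DecidableEq ι] in
/-- `Q_W∘M_χ = Q_{W̃}∘M_χ` when the path kernels agree at every start `(x, κ)` with `B(x) ∈ S` or `B(x) + e_κ ∈ S` (`S ⊇ B(supp χ)`), all lengths `< n`.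
[cite: Balaban1984PropagatorsI, (1.18) p.20 (shape); Balaban1985BackgroundPropagators, Cor. 3.8 p.410 (locality: mechanism)] -/
theorem qvKer_comp_mulOp_congr_of_blocks {W Wt : Tor (fine n M) × Fin (d + 1) → ℕ → Matrix ι ι ℝ} {χ : Tor (fine n M) × Fin (d + 1) → ℝ} {S : Finset (Tor M)}
    (hχS : ∀ p, χ p ≠ 0 → blockOf n M p.1 ∈ S)
    (hW : ∀ (x : Tor (fine n M)) (κ : Fin (d + 1)) (t : ℕ), t < n → (blockOf n M x ∈ S ∨ blockOf n M x + unitVec M κ ∈ S) → W (x, κ) t = Wt (x, κ) t) :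
    qvKer M n W ∘ₗ mulOp (fun q : (Tor (fine n M) × Fin (d + 1)) × ι => χ q.1) = qvKer M n Wt ∘ₗ mulOp (fun q : (Tor (fine n M) × Fin (d + 1)) × ι => χ q.1) := by
  refine LinearMap.ext fun f => funext fun q => ?_
  obtain ⟨⟨y, κ⟩, i⟩ := q
  rw [LinearMap.comp_apply, LinearMap.comp_apply]
  by_cases hnear : y ∈ S ∨ y + unitVec M κ ∈ S
  · rw [qvKer_apply, qvKer_apply]
    refine congrArg _ (sum_congr rfl fun x hx => congrArg _ (sum_congr rfl fun s hs => sum_congr rfl fun j _ => ?_))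
    have hxy : blockOf n M x = y := (mem_fibre _ _ _).mp hx
    rw [hW x κ s (mem_range.mp hs) (by rw [hxy]; exact hnear)]
  · push Not at hnear
    rw [qvKer_mulOp_apply_eq_zero M n _ hχS hnear.1 hnear.2, qvKer_mulOp_apply_eq_zero M n _ hχS hnear.1 hnear.2]

omit [DecidableEq ι] in
/-- `Q*_W v = Q*_{W̃} v` for coarse bond functions `v` vanishing at the bonds `(y, κ)` with neither `y` nor `y + e_κ` in `S`, kernels agreeing as above.
[cite: Balaban1984PropagatorsI, (1.18) p.20, (1.69) p.29 («Q*»: shape)] -/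
theorem qvAdjKer_apply_congr_of_blocks {W Wt : Tor (fine n M) × Fin (d + 1) → ℕ → Matrix ι ι ℝ} {S : Finset (Tor M)}
    (hW : ∀ (x : Tor (fine n M)) (κ : Fin (d + 1)) (t : ℕ), t < n → (blockOf n M x ∈ S ∨ blockOf n M x + unitVec M κ ∈ S) → W (x, κ) t = Wt (x, κ) t)
    {v : (Tor M × Fin (d + 1)) × ι → ℝ} (hv : ∀ y κ i, ¬ (y ∈ S ∨ y + unitVec M κ ∈ S) → v ((y, κ), i) = 0) : qvAdjKer M n W v = qvAdjKer M n Wt v := by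
  funext p
  obtain ⟨⟨x', κ⟩, j⟩ := p
  rw [qvAdjKer_apply, qvAdjKer_apply]
  refine congrArg _ (sum_congr rfl fun s hs => sum_congr rfl fun i _ => ?_)
  dsimp only
  by_cases hnear : blockOf n M (x' - s • unitVec (fine n M) κ) ∈ S ∨ blockOf n M (x' - s • unitVec (fine n M) κ) + unitVec M κ ∈ S
  · rw [hW _ κ s (mem_range.mp hs) hnear]
  · rw [hv _ _ _ hnear, mul_zero, mul_zero]

omit [DecidableEq ι] in
/-- ★ **`Q*_W∘Q_W∘M_χ = Q*_{W̃}∘Q_{W̃}∘M_χ`** when the kernels agree at every start `(x, κ)`, `B(x) ∈ S ∨ B(x) + e_κ ∈ S`, `S ⊇ B(supp χ)` — the cut averaging word reads the path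
kernels only there. [cite: Balaban1985BackgroundPropagators, (3.59)–(3.60) p.402, Cor. 3.8 p.410 (locality: mechanism)] -/
theorem adjKer_comp_ker_comp_mulOp_congr_of_blocks {W Wt : Tor (fine n M) × Fin (d + 1) → ℕ → Matrix ι ι ℝ} {χ : Tor (fine n M) × Fin (d + 1) → ℝ} {S : Finset (Tor M)}
    (hχS : ∀ p, χ p ≠ 0 → blockOf n M p.1 ∈ S)
    (hW : ∀ (x : Tor (fine n M)) (κ : Fin (d + 1)) (t : ℕ), t < n → (blockOf n M x ∈ S ∨ blockOf n M x + unitVec M κ ∈ S) → W (x, κ) t = Wt (x, κ) t) :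
    (qvAdjKer M n W ∘ₗ qvKer M n W) ∘ₗ mulOp (fun q : (Tor (fine n M) × Fin (d + 1)) × ι => χ q.1) =
      (qvAdjKer M n Wt ∘ₗ qvKer M n Wt) ∘ₗ mulOp (fun q : (Tor (fine n M) × Fin (d + 1)) × ι => χ q.1) := by
  refine LinearMap.ext fun f => ?_
  rw [LinearMap.comp_apply, LinearMap.comp_apply, LinearMap.comp_apply, LinearMap.comp_apply]
  have hQ : qvKer M n W (mulOp (fun q : (Tor (fine n M) × Fin (d + 1)) × ι => χ q.1) f) = qvKer M n Wt (mulOp (fun q : (Tor (fine n M) × Fin (d + 1)) × ι => χ q.1) f) := by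
    have h := LinearMap.congr_fun (qvKer_comp_mulOp_congr_of_blocks M n (ι := ι) hχS hW) f
    rwa [LinearMap.comp_apply, LinearMap.comp_apply] at h
  rw [hQ]
  exact qvAdjKer_apply_congr_of_blocks M n hW fun y κ i hfar => by
    push Not at hfar
    exact qvKer_mulOp_apply_eq_zero M n _ hχS hfar.1 hfar.2 f i

end Kernels

end Summit.QuantumFields.YangMills.BalabanUVNodes.N15.CovAvg

/-! ## §2 The two-grid row of `N_V^Q` behind the cuts from box-local data -/

namespace Summit.QuantumFields.YangMills.BalabanUVNodes.N15.Gluing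

open Real NormedSpace
open Literature.MathematicalPhysics.QuantumFieldTheory.Balaban1983to89
open Literature.MathematicalPhysics.QuantumFieldTheory.Balaban1983to89.B11SectG (BlockNorm HasMaj)
open Literature.MathematicalPhysics.QuantumFieldTheory.Balaban1983to89.B6Prop26Gluing (mulOp mulOp_apply)
open Literature.MathematicalPhysics.QuantumFieldTheory.Balaban1983to89.B6UnitTorusCarrier (unitTorusGeo unitTorusGeo_dist)
open Literature.MathematicalPhysics.QuantumFieldTheory.Balaban1983to89.T4EtaRateDefect (idef)
open Literature.MathematicalPhysics.QuantumFieldTheory.Balaban1983to89.T4EtaRateCoeffDefect (pull)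
open Literature.MathematicalPhysics.QuantumFieldTheory.Balaban1983to89.B5Prop11Plancherel (Tor fine unitVec)
open Literature.MathematicalPhysics.QuantumFieldTheory.King1986.Torus (blockOf tdistT)
open Summit.QuantumFields.YangMills.BalabanUVNodes.N15.VectorPiece (tensorId kingPr kingPrV)
open Summit.QuantumFields.YangMills.BalabanUVNodes.N15.MatrixSpecies (coordMat basisConst basisConst_nonneg liftBlk liftMap)
open Summit.QuantumFields.YangMills.BalabanUVNodes.N15.TwoGrid (qvRe qvAdjRe)
open Summit.QuantumFields.YangMills.BalabanUVNodes.N15.CovAvg (cvaPath qvKer qvAdjKer qvCov qvCovAdj holPath rows_cvaPath_conj_sub_le cols_cvaPath_conj_sub_le kingPr_sub_mul_smul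
  blockOf_kingPr rows_cvaPath_le cols_cvaPath_le)

variable {d : ℕ}

section Rows

open scoped Matrix.Norms.L2Operator

variable {L : ℕ} [NeZero L] {mm : Type} [Fintype mm] [DecidableEq mm] {ι : Type} [Fintype ι] [DecidableEq ι] (e : Matrix mm mm ℂ ≃L[ℝ] (ι → ℝ))
variable (mv kk r : ℕ) (hL : Odd L ∧ 1 < L) (a : ℝ)

set_option maxHeartbeats 800000 in
/-- ★★★ **THE TWO-GRID ROWS OF `N_V^Q` (`hDNV`, `hDfarN` of FILE 123) FROM BOX-LOCAL DATA** (n15-c∕`cv_hasMaj_idef_sandwich_cvNVq` localised by KERNEL extension): for cuts `|f|, |χ| ≤ 1`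
read on the fine carrier through `π̂`, with `B(supp χ) ⊆ S`, `S ∪ (S ± e_κ) ⊆ E` stepwise; transporter letters `ρ` (coarse rows∕columns), `ρ₁` (fine columns) at the bond points whose unit
block lies in `E`; the holonomy fit `Φ` for the admissible two-grid path pairs whose start block and `μ`-neighbour lie in `E`; `U, U′` unitary:
`idef P̂ P̂ (M_{f∘π̂}∘N_V^Q′(U′)∘M_{χ∘π̂}) (M_f∘N_V^Q(U)∘M_χ) ≤ |a|·c_δe^{3δ}·(4∕L^k + (φ + 2(1+ρ)^{(d+2)L^k}∕L^k)(2 + K + K₁))·e^{−δd}`, `φ = |ι|κ_e·2√m·√m·Φ` — the GLOBAL row's constant.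
[cite: Balaban1985BackgroundPropagators, (3.26) p.395, (3.35) p.396, (3.76)–(3.77) p.406, Cor. 3.8 p.410 (mechanism); King1986, (2.1) p.664] -/
theorem cv_hasMaj_idef_sandwich_cvNVq_local {U : Fin (d + 1) → CvX d L mv kk hL → Matrix mm mm ℂ} {U' : Fin (d + 1) → CvX' d L mv kk r hL → Matrix mm mm ℂ} {ρ ρ₁ Φ δ : ℝ}
    (hρ : 0 ≤ ρ) (hρ₁ : 0 ≤ ρ₁) (hΦ : 0 ≤ Φ) (hδ : 0 < δ)
    {S E : Finset (Tor (cvM d L mv kk hL))} (hE : ∀ y κ, (y ∈ S ∨ y + unitVec (cvM d L mv kk hL) κ ∈ S) → y ∈ E ∧ y + unitVec (cvM d L mv kk hL) κ ∈ E)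
    (hTr : ∀ μ (p : CvX d L mv kk hL), blockOf (L ^ kk) (cvM d L mv kk hL) p.1 ∈ E → ∀ i, ∑ j, |(cvT e U μ p - 1) i j| ≤ ρ)
    (hTc : ∀ μ (p : CvX d L mv kk hL), blockOf (L ^ kk) (cvM d L mv kk hL) p.1 ∈ E → ∀ j, ∑ i, |(cvT e U μ p - 1) i j| ≤ ρ)
    (hTc' : ∀ μ (p : CvX' d L mv kk r hL), blockOf (L ^ r * L ^ kk) (cvM d L mv kk hL) p.1 ∈ E → ∀ j, ∑ i, |(cvT e U' μ p - 1) i j| ≤ ρ₁)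
    (hUu : ∀ μ p, (U μ p)ᴴ * U μ p = 1) (hU'u : ∀ μ p, (U' μ p)ᴴ * U' μ p = 1)
    (hhol : ∀ (x' : Tor (fine (L ^ r * L ^ kk) (cvM d L mv kk hL))) (μ : Fin (d + 1)) (s j δ' : ℕ), s < L ^ kk → j < L ^ r → δ' ≤ 1 →
      kingPr L kk r (cvM d L mv kk hL) (x' + j • unitVec (fine (L ^ r * L ^ kk) (cvM d L mv kk hL)) μ) = kingPr L kk r (cvM d L mv kk hL) x' + δ' • unitVec (fine (L ^ kk) (cvM d L mv kk hL)) μ →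
      blockOf (L ^ kk) (cvM d L mv kk hL) (kingPr L kk r (cvM d L mv kk hL) x') ∈ E → blockOf (L ^ kk) (cvM d L mv kk hL) (kingPr L kk r (cvM d L mv kk hL) x') + unitVec (cvM d L mv kk hL) μ ∈ E →
      ‖holPath (cvM d L mv kk hL) (L ^ r * L ^ kk) U' (x', μ) (L ^ r * s + j) - holPath (cvM d L mv kk hL) (L ^ kk) U (kingPr L kk r (cvM d L mv kk hL) x', μ) (s + δ')‖ ≤ Φ)
    (f χ : CvX d L mv kk hL → ℝ) (hf : ∀ x, |f x| ≤ 1) (hχ : ∀ x, |χ x| ≤ 1) (hχS : ∀ p : CvX d L mv kk hL, χ p ≠ 0 → blockOf (L ^ kk) (cvM d L mv kk hL) p.1 ∈ S) :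
    HasMaj (CvNorm d L mv kk hL ι) (BlockNorm.ofBlocks (unitTorusGeo L kk (cvM d L mv kk hL)) (liftBlk (cvBlk d L mv kk hL ∘ kingPrV L kk r (cvM d L mv kk hL)) ι))
      (idef (pull (liftMap (kingPrV L kk r (cvM d L mv kk hL)) ι)) (pull (liftMap (kingPrV L kk r (cvM d L mv kk hL)) ι))
        (mulOp ((fun p : CvX d L mv kk hL × ι => f p.1) ∘ liftMap (kingPrV L kk r (cvM d L mv kk hL)) ι) ∘ₗ cvNVq' d L mv kk r hL a ι e U' ∘ₗ
          mulOp ((fun p : CvX d L mv kk hL × ι => χ p.1) ∘ liftMap (kingPrV L kk r (cvM d L mv kk hL)) ι))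
        (mulOp (fun p : CvX d L mv kk hL × ι => f p.1) ∘ₗ cvNVq d L mv kk hL a ι e U ∘ₗ mulOp (fun p : CvX d L mv kk hL × ι => χ p.1)))
      (fun y y' => |a| * (B4Sect5Proof.latticeConst (d + 1) δ * Real.exp (3 * δ)) *
        (4 / (L ^ kk : ℕ) + (Fintype.card ι * (@basisConst ι _ (Matrix mm mm ℂ) Matrix.frobeniusNormedAddCommGroup Matrix.frobeniusNormedSpace e * (2 * Real.sqrt (Fintype.card mm)) * (Real.sqrt (Fintype.card mm) * Φ)) +
          2 * ((1 + ρ) ^ ((d + 2) * L ^ kk)) / (L ^ kk : ℕ)) * (2 + ((1 + ρ) ^ ((d + 2) * L ^ kk) - 1) + ((1 + ρ₁) ^ ((d + 2) * (L ^ r * L ^ kk)) - 1))) *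
        Real.exp (-(δ * (unitTorusGeo L kk (cvM d L mv kk hL)).dist y y'))) := by
  classical
  have hκ := @basisConst_nonneg ι _ (Matrix mm mm ℂ) Matrix.frobeniusNormedAddCommGroup Matrix.frobeniusNormedSpace e
  have hφ : 0 ≤ Fintype.card ι * (@basisConst ι _ (Matrix mm mm ℂ) Matrix.frobeniusNormedAddCommGroup Matrix.frobeniusNormedSpace e * (2 * Real.sqrt (Fintype.card mm)) * (Real.sqrt (Fintype.card mm) * Φ)) := by positivity
  have hnpos : 0 < L ^ kk := pow_pos (Nat.pos_of_ne_zero (NeZero.ne L)) kk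
  have hrpos : 0 < L ^ r := pow_pos (Nat.pos_of_ne_zero (NeZero.ne L)) r
  -- (1) the fields extended by `𝟙` off `E` and their GLOBAL letters
  let V : Fin (d + 1) → CvX d L mv kk hL → Matrix mm mm ℂ := fun μ p => if blockOf (L ^ kk) (cvM d L mv kk hL) p.1 ∈ E then U μ p else 1
  let V' : Fin (d + 1) → CvX' d L mv kk r hL → Matrix mm mm ℂ := fun μ p => if blockOf (L ^ r * L ^ kk) (cvM d L mv kk hL) p.1 ∈ E then U' μ p else 1
  have hVE : ∀ μ (p : CvX d L mv kk hL), blockOf (L ^ kk) (cvM d L mv kk hL) p.1 ∈ E → cvT e V μ p = cvT e U μ p := fun μ p hp => by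
    simp only [cvT, V, if_pos hp]
  have hV'E : ∀ μ (p : CvX' d L mv kk r hL), blockOf (L ^ r * L ^ kk) (cvM d L mv kk hL) p.1 ∈ E → cvT e V' μ p = cvT e U' μ p := fun μ p hp => by
    simp only [cvT, V', if_pos hp]
  have hV1 : ∀ μ (p : CvX d L mv kk hL), blockOf (L ^ kk) (cvM d L mv kk hL) p.1 ∉ E → cvT e V μ p = 1 := fun μ p hp => by
    simp only [cvT, V, if_neg hp]; exact CurvedSpecies.coordMat_conj_one e
  have hV'1 : ∀ μ (p : CvX' d L mv kk r hL), blockOf (L ^ r * L ^ kk) (cvM d L mv kk hL) p.1 ∉ E → cvT e V' μ p = 1 := fun μ p hp => by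
    simp only [cvT, V', if_neg hp]; exact CurvedSpecies.coordMat_conj_one e
  have hVr : ∀ μ (p : CvX d L mv kk hL) i, ∑ j, |(cvT e V μ p - 1) i j| ≤ ρ := fun μ p i => by
    by_cases hp : blockOf (L ^ kk) (cvM d L mv kk hL) p.1 ∈ E
    · rw [hVE μ p hp]; exact hTr μ p hp i
    · rw [hV1 μ p hp, sub_self]; simp only [Matrix.zero_apply, abs_zero, Finset.sum_const_zero]; exact hρ
  have hVc : ∀ μ (p : CvX d L mv kk hL) j, ∑ i, |(cvT e V μ p - 1) i j| ≤ ρ := fun μ p j => by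
    by_cases hp : blockOf (L ^ kk) (cvM d L mv kk hL) p.1 ∈ E
    · rw [hVE μ p hp]; exact hTc μ p hp j
    · rw [hV1 μ p hp, sub_self]; simp only [Matrix.zero_apply, abs_zero, Finset.sum_const_zero]; exact hρ
  have hV'c : ∀ μ (p : CvX' d L mv kk r hL) j, ∑ i, |(cvT e V' μ p - 1) i j| ≤ ρ₁ := fun μ p j => by
    by_cases hp : blockOf (L ^ r * L ^ kk) (cvM d L mv kk hL) p.1 ∈ E
    · rw [hV'E μ p hp]; exact hTc' μ p hp j
    · rw [hV'1 μ p hp, sub_self]; simp only [Matrix.zero_apply, abs_zero, Finset.sum_const_zero]; exact hρ₁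
  -- the transports of the extended fields agree with the originals on paths inside `E`
  have hpathV : ∀ (x : Tor (fine (L ^ kk) (cvM d L mv kk hL))) (κ : Fin (d + 1)) (t : ℕ), t ≤ (L ^ kk) → blockOf (L ^ kk) (cvM d L mv kk hL) x ∈ E → blockOf (L ^ kk) (cvM d L mv kk hL) x + unitVec (cvM d L mv kk hL) κ ∈ E →
      cvaPath (cvM d L mv kk hL) (L ^ kk) (cvT e V) (x, κ) t = cvaPath (cvM d L mv kk hL) (L ^ kk) (cvT e U) (x, κ) t := fun x κ t ht h0 h1 =>
    CovAvg.cvaPath_congr_of_blockOf (cvM d L mv kk hL) (L ^ kk) (fun ν p hp => hVE ν p (by rcases hp with hp | hp <;> [exact hp ▸ h0; exact hp ▸ h1])) ht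
  have hpathV' : ∀ (x' : Tor (fine (L ^ r * L ^ kk) (cvM d L mv kk hL))) (κ : Fin (d + 1)) (t : ℕ), t ≤ (L ^ r * L ^ kk) → blockOf (L ^ r * L ^ kk) (cvM d L mv kk hL) x' ∈ E → blockOf (L ^ r * L ^ kk) (cvM d L mv kk hL) x' + unitVec (cvM d L mv kk hL) κ ∈ E →
      cvaPath (cvM d L mv kk hL) (L ^ r * L ^ kk) (cvT e V') (x', κ) t = cvaPath (cvM d L mv kk hL) (L ^ r * L ^ kk) (cvT e U') (x', κ) t := fun x' κ t ht h0 h1 =>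
    CovAvg.cvaPath_congr_of_blockOf (cvM d L mv kk hL) (L ^ r * L ^ kk) (fun ν p hp => hV'E ν p (by rcases hp with hp | hp <;> [exact hp ▸ h0; exact hp ▸ h1])) ht
  -- (2) the path kernels extended by `1` off the pairs of blocks inside `E`
  obtain ⟨W, hW⟩ : ∃ W : Tor (fine (L ^ kk) (cvM d L mv kk hL)) × Fin (d + 1) → ℕ → Matrix ι ι ℝ, ∀ p t, W p t =
      if blockOf (L ^ kk) (cvM d L mv kk hL) p.1 ∈ E ∧ blockOf (L ^ kk) (cvM d L mv kk hL) p.1 + unitVec (cvM d L mv kk hL) p.2 ∈ E then cvaPath (cvM d L mv kk hL) (L ^ kk) (cvT e V) p t else 1 := ⟨fun p t => if blockOf (L ^ kk) (cvM d L mv kk hL) p.1 ∈ E ∧ blockOf (L ^ kk) (cvM d L mv kk hL) p.1 + unitVec (cvM d L mv kk hL) p.2 ∈ E then cvaPath (cvM d L mv kk hL) (L ^ kk) (cvT e V) p t else 1, fun p t => rfl⟩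
  obtain ⟨W', hW'⟩ : ∃ W' : Tor (fine (L ^ r * L ^ kk) (cvM d L mv kk hL)) × Fin (d + 1) → ℕ → Matrix ι ι ℝ, ∀ p t, W' p t =
      if blockOf (L ^ r * L ^ kk) (cvM d L mv kk hL) p.1 ∈ E ∧ blockOf (L ^ r * L ^ kk) (cvM d L mv kk hL) p.1 + unitVec (cvM d L mv kk hL) p.2 ∈ E then cvaPath (cvM d L mv kk hL) (L ^ r * L ^ kk) (cvT e V') p t else 1 := ⟨fun p t => if blockOf (L ^ r * L ^ kk) (cvM d L mv kk hL) p.1 ∈ E ∧ blockOf (L ^ r * L ^ kk) (cvM d L mv kk hL) p.1 + unitVec (cvM d L mv kk hL) p.2 ∈ E then cvaPath (cvM d L mv kk hL) (L ^ r * L ^ kk) (cvT e V') p t else 1, fun p t => rfl⟩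
  -- (3) their row∕column bounds
  set K : ℝ := (1 + ρ) ^ ((d + 2) * (L ^ kk)) - 1 with hKdef
  set K' : ℝ := (1 + ρ₁) ^ ((d + 2) * (L ^ r * L ^ kk)) - 1 with hK'def
  have hK : 0 ≤ K := by have := one_le_pow₀ (M₀ := ℝ) (a := 1 + ρ) (by linarith) (n := (d + 2) * (L ^ kk)); rw [hKdef]; linarith
  have hK' : 0 ≤ K' := by have := one_le_pow₀ (M₀ := ℝ) (a := 1 + ρ₁) (by linarith) (n := (d + 2) * (L ^ r * L ^ kk)); rw [hK'def]; linarith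
  have hrow1 : ∀ i : ι, ∑ c, |(1 : Matrix ι ι ℝ) i c| = 1 := fun i => by
    simp only [Matrix.one_apply, apply_ite abs, abs_one, abs_zero, Finset.sum_ite_eq, Finset.mem_univ, if_true]
  have hcol1 : ∀ c : ι, ∑ i, |(1 : Matrix ι ι ℝ) i c| = 1 := fun c => by
    simp only [Matrix.one_apply, apply_ite abs, abs_one, abs_zero, Finset.sum_ite_eq', Finset.mem_univ, if_true]
  have hWr : ∀ p t, t ≤ (L ^ kk) → ∀ i, ∑ c, |W p t i c| ≤ 1 + K := fun p t ht i => by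
    rw [hW]; split_ifs
    · rw [hKdef, add_sub_cancel]; exact rows_cvaPath_le (cvM d L mv kk hL) (L ^ kk) hρ hVr p ht i
    · rw [hrow1]; linarith
  have hWc : ∀ p t, t ≤ (L ^ kk) → ∀ c, ∑ i, |W p t i c| ≤ 1 + K := fun p t ht c => by
    rw [hW]; split_ifs
    · rw [hKdef, add_sub_cancel]; exact cols_cvaPath_le (cvM d L mv kk hL) (L ^ kk) hρ hVc p ht c
    · rw [hcol1]; linarith
  have hW'c : ∀ p t, t ≤ (L ^ r * L ^ kk) → ∀ c, ∑ i, |W' p t i c| ≤ 1 + K' := fun p t ht c => by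
    rw [hW']; split_ifs
    · rw [hK'def, add_sub_cancel]; exact cols_cvaPath_le (cvM d L mv kk hL) (L ^ r * L ^ kk) hρ₁ hV'c p ht c
    · rw [hcol1]; linarith
  -- (4) the two-grid kernel fits: the SAME block criterion for the paired paths; `0` outside, the local holonomy fit inside
  have hlen : ∀ s j : ℕ, s < L ^ kk → j < L ^ r → L ^ r * s + j ≤ (L ^ r * L ^ kk) := fun s j hs hj => by
    have h1 : L ^ r * s + j < L ^ r * (s + 1) := by nlinarith
    have h2 : L ^ r * (s + 1) ≤ L ^ r * L ^ kk := Nat.mul_le_mul_left _ hs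
    omega
  have hsum0 : ∀ i : ι, ∑ c : ι, |((1 : Matrix ι ι ℝ) - 1) i c| ≤ Fintype.card ι * (@basisConst ι _ (Matrix mm mm ℂ) Matrix.frobeniusNormedAddCommGroup Matrix.frobeniusNormedSpace e * (2 * Real.sqrt (Fintype.card mm)) * (Real.sqrt (Fintype.card mm) * Φ)) := fun i => by
    rw [sub_self]; simp only [Matrix.zero_apply, abs_zero, Finset.sum_const_zero]; exact hφ
  have hfit : ∀ (x' : Tor (fine (L ^ r * L ^ kk) (cvM d L mv kk hL))) (μ : Fin (d + 1)) (s j δ' : ℕ), s < L ^ kk → j < L ^ r → δ' ≤ 1 →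
      kingPr L kk r (cvM d L mv kk hL) (x' + j • unitVec (fine (L ^ r * L ^ kk) (cvM d L mv kk hL)) μ) = kingPr L kk r (cvM d L mv kk hL) x' + δ' • unitVec (fine (L ^ kk) (cvM d L mv kk hL)) μ →
      ∀ i, ∑ c, |(W' (x', μ) (L ^ r * s + j) - W (kingPr L kk r (cvM d L mv kk hL) x', μ) (s + δ')) i c| ≤ Fintype.card ι * (@basisConst ι _ (Matrix mm mm ℂ) Matrix.frobeniusNormedAddCommGroup Matrix.frobeniusNormedSpace e * (2 * Real.sqrt (Fintype.card mm)) * (Real.sqrt (Fintype.card mm) * Φ)) := by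
    intro x' μ s j δ' hs hj hδ' hπ i
    have hb : blockOf (L ^ r * L ^ kk) (cvM d L mv kk hL) x' = blockOf (L ^ kk) (cvM d L mv kk hL) (kingPr L kk r (cvM d L mv kk hL) x') := (blockOf_kingPr (cvM d L mv kk hL) L kk r x').symm
    rw [hW', hW]
    by_cases hc : blockOf (L ^ kk) (cvM d L mv kk hL) (kingPr L kk r (cvM d L mv kk hL) x') ∈ E ∧ blockOf (L ^ kk) (cvM d L mv kk hL) (kingPr L kk r (cvM d L mv kk hL) x') + unitVec (cvM d L mv kk hL) μ ∈ E
    · have hc' : blockOf (L ^ r * L ^ kk) (cvM d L mv kk hL) x' ∈ E ∧ blockOf (L ^ r * L ^ kk) (cvM d L mv kk hL) x' + unitVec (cvM d L mv kk hL) μ ∈ E := by rw [hb]; exact hc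
      rw [if_pos hc', if_pos hc, hpathV' x' μ _ (hlen s j hs hj) hc'.1 hc'.2, hpathV _ μ _ (by omega) hc.1 hc.2]
      refine (rows_cvaPath_conj_sub_le e hU'u hUu (x', μ) (L ^ r * s + j) (kingPr L kk r (cvM d L mv kk hL) x', μ) (s + δ') i).trans ?_
      have h := hhol x' μ s j δ' hs hj hδ' hπ hc.1 hc.2
      gcongr
    · have hc' : ¬ (blockOf (L ^ r * L ^ kk) (cvM d L mv kk hL) x' ∈ E ∧ blockOf (L ^ r * L ^ kk) (cvM d L mv kk hL) x' + unitVec (cvM d L mv kk hL) μ ∈ E) := by rw [hb]; exact hc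
      rw [if_neg hc', if_neg hc]; exact hsum0 i
  have hsum0' : ∀ c : ι, ∑ i : ι, |((1 : Matrix ι ι ℝ) - 1) i c| ≤ Fintype.card ι * (@basisConst ι _ (Matrix mm mm ℂ) Matrix.frobeniusNormedAddCommGroup Matrix.frobeniusNormedSpace e * (2 * Real.sqrt (Fintype.card mm)) * (Real.sqrt (Fintype.card mm) * Φ)) := fun c => by
    rw [sub_self]; simp only [Matrix.zero_apply, abs_zero, Finset.sum_const_zero]; exact hφ
  have hfitA : ∀ (x' : Tor (fine (L ^ r * L ^ kk) (cvM d L mv kk hL))) (κ : Fin (d + 1)) (s j δ' : ℕ), s < L ^ kk → j < L ^ r → δ' ≤ 1 →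
      kingPr L kk r (cvM d L mv kk hL) (x' - j • unitVec (fine (L ^ r * L ^ kk) (cvM d L mv kk hL)) κ) = kingPr L kk r (cvM d L mv kk hL) x' - δ' • unitVec (fine (L ^ kk) (cvM d L mv kk hL)) κ →
      ∀ c, ∑ i, |(W' (x' - (L ^ r * s + j) • unitVec (fine (L ^ r * L ^ kk) (cvM d L mv kk hL)) κ, κ) (L ^ r * s + j) -
        W (kingPr L kk r (cvM d L mv kk hL) x' - (s + δ') • unitVec (fine (L ^ kk) (cvM d L mv kk hL)) κ, κ) (s + δ')) i c| ≤ Fintype.card ι * (@basisConst ι _ (Matrix mm mm ℂ) Matrix.frobeniusNormedAddCommGroup Matrix.frobeniusNormedSpace e * (2 * Real.sqrt (Fintype.card mm)) * (Real.sqrt (Fintype.card mm) * Φ)) := by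
    intro x' κ s j δ' hs hj hδ' hπ c
    -- the shifted base points pair up (n15-c∕`cv_fitA_of_hol`'s computation)
    set x'' : Tor (fine (L ^ r * L ^ kk) (cvM d L mv kk hL)) := x' - (L ^ r * s + j) • unitVec (fine (L ^ r * L ^ kk) (cvM d L mv kk hL)) κ with hx''
    have h1 : x'' + j • unitVec (fine (L ^ r * L ^ kk) (cvM d L mv kk hL)) κ = x' - (L ^ r * s) • unitVec (fine (L ^ r * L ^ kk) (cvM d L mv kk hL)) κ := by
      rw [hx'', add_smul]; abel
    have h2 : x'' = (x' - j • unitVec (fine (L ^ r * L ^ kk) (cvM d L mv kk hL)) κ) - (L ^ r * s) • unitVec (fine (L ^ r * L ^ kk) (cvM d L mv kk hL)) κ := by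
      rw [hx'', add_smul]; abel
    have hπ'' : kingPr L kk r (cvM d L mv kk hL) x'' = kingPr L kk r (cvM d L mv kk hL) x' - (s + δ') • unitVec (fine (L ^ kk) (cvM d L mv kk hL)) κ := by
      rw [h2, kingPr_sub_mul_smul, hπ, add_smul]; abel
    have hπfit : kingPr L kk r (cvM d L mv kk hL) (x'' + j • unitVec (fine (L ^ r * L ^ kk) (cvM d L mv kk hL)) κ) = kingPr L kk r (cvM d L mv kk hL) x'' + δ' • unitVec (fine (L ^ kk) (cvM d L mv kk hL)) κ := by
      rw [h1, kingPr_sub_mul_smul, hπ'', add_smul]; abel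
    rw [← hπ'']
    have hb : blockOf (L ^ r * L ^ kk) (cvM d L mv kk hL) x'' = blockOf (L ^ kk) (cvM d L mv kk hL) (kingPr L kk r (cvM d L mv kk hL) x'') := (blockOf_kingPr (cvM d L mv kk hL) L kk r x'').symm
    rw [hW', hW]
    by_cases hc : blockOf (L ^ kk) (cvM d L mv kk hL) (kingPr L kk r (cvM d L mv kk hL) x'') ∈ E ∧ blockOf (L ^ kk) (cvM d L mv kk hL) (kingPr L kk r (cvM d L mv kk hL) x'') + unitVec (cvM d L mv kk hL) κ ∈ E
    · have hc' : blockOf (L ^ r * L ^ kk) (cvM d L mv kk hL) x'' ∈ E ∧ blockOf (L ^ r * L ^ kk) (cvM d L mv kk hL) x'' + unitVec (cvM d L mv kk hL) κ ∈ E := by rw [hb]; exact hc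
      rw [if_pos hc', if_pos hc, hpathV' x'' κ _ (hlen s j hs hj) hc'.1 hc'.2, hpathV _ κ _ (by omega) hc.1 hc.2]
      refine (cols_cvaPath_conj_sub_le e hU'u hUu (x'', κ) (L ^ r * s + j) (kingPr L kk r (cvM d L mv kk hL) x'', κ) (s + δ') c).trans ?_
      have h := hhol x'' κ s j δ' hs hj hδ' hπfit hc.1 hc.2
      gcongr
    · have hc' : ¬ (blockOf (L ^ r * L ^ kk) (cvM d L mv kk hL) x'' ∈ E ∧ blockOf (L ^ r * L ^ kk) (cvM d L mv kk hL) x'' + unitVec (cvM d L mv kk hL) κ ∈ E) := by rw [hb]; exact hc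
      rw [if_neg hc', if_neg hc]; exact hsum0' c
  -- (5) the kernel-generic two-grid defect lemma (n15-c∕325) at the extended kernels
  have h325 := CovAvg.hasMaj_idef_nvKer (L := L) (cvM d L mv kk hL) kk r (ι := ι) hK hK' hφ hδ hWr hWc hW'c hfit hfitA a
  rw [liftBlk_blockOf_fine_eq (ι := ι) mv kk r hL] at h325
  -- (6) behind the cuts the words read the extended kernels
  have hnearW : ∀ (x : Tor (fine (L ^ kk) (cvM d L mv kk hL))) (κ : Fin (d + 1)) (t : ℕ), t < (L ^ kk) → (blockOf (L ^ kk) (cvM d L mv kk hL) x ∈ S ∨ blockOf (L ^ kk) (cvM d L mv kk hL) x + unitVec (cvM d L mv kk hL) κ ∈ S) →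
      cvaPath (cvM d L mv kk hL) (L ^ kk) (cvT e U) (x, κ) t = W (x, κ) t := fun x κ t ht hnr => by
    obtain ⟨h0, h1⟩ := hE _ κ hnr
    rw [hW, if_pos ⟨h0, h1⟩, hpathV x κ t ht.le h0 h1]
  have hnearW' : ∀ (x' : Tor (fine (L ^ r * L ^ kk) (cvM d L mv kk hL))) (κ : Fin (d + 1)) (t : ℕ), t < (L ^ r * L ^ kk) → (blockOf (L ^ r * L ^ kk) (cvM d L mv kk hL) x' ∈ S ∨ blockOf (L ^ r * L ^ kk) (cvM d L mv kk hL) x' + unitVec (cvM d L mv kk hL) κ ∈ S) →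
      cvaPath (cvM d L mv kk hL) (L ^ r * L ^ kk) (cvT e U') (x', κ) t = W' (x', κ) t := fun x' κ t ht hnr => by
    obtain ⟨h0, h1⟩ := hE _ κ hnr
    rw [hW', if_pos ⟨h0, h1⟩, hpathV' x' κ t ht.le h0 h1]
  have hχS' : ∀ p : CvX' d L mv kk r hL, χ (kingPrV L kk r (cvM d L mv kk hL) p) ≠ 0 → blockOf (L ^ r * L ^ kk) (cvM d L mv kk hL) p.1 ∈ S := fun p hp => by
    rw [← blockOf_kingPr (cvM d L mv kk hL) L kk r p.1]; exact hχS _ hp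
  have hcoarse : cvNVq d L mv kk hL a ι e U ∘ₗ mulOp (fun p : CvX d L mv kk hL × ι => χ p.1) =
      (a • (tensorId ι (qvAdjRe (cvM d L mv kk hL) (L ^ kk) ∘ₗ qvRe (cvM d L mv kk hL) (L ^ kk)) - qvAdjKer (cvM d L mv kk hL) (L ^ kk) W ∘ₗ qvKer (cvM d L mv kk hL) (L ^ kk) W)) ∘ₗ mulOp (fun p : CvX d L mv kk hL × ι => χ p.1) := by
    rw [show cvNVq d L mv kk hL a ι e U = a • (tensorId ι (qvAdjRe (cvM d L mv kk hL) (L ^ kk) ∘ₗ qvRe (cvM d L mv kk hL) (L ^ kk)) -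
        qvAdjKer (cvM d L mv kk hL) (L ^ kk) (cvaPath (cvM d L mv kk hL) (L ^ kk) (cvT e U)) ∘ₗ qvKer (cvM d L mv kk hL) (L ^ kk) (cvaPath (cvM d L mv kk hL) (L ^ kk) (cvT e U))) from rfl,
      LinearMap.smul_comp, LinearMap.smul_comp, LinearMap.sub_comp, LinearMap.sub_comp,
      CovAvg.adjKer_comp_ker_comp_mulOp_congr_of_blocks (cvM d L mv kk hL) (L ^ kk) hχS hnearW]
  have hfine : cvNVq' d L mv kk r hL a ι e U' ∘ₗ mulOp ((fun p : CvX d L mv kk hL × ι => χ p.1) ∘ liftMap (kingPrV L kk r (cvM d L mv kk hL)) ι) =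
      (a • (tensorId ι (qvAdjRe (cvM d L mv kk hL) (L ^ r * L ^ kk) ∘ₗ qvRe (cvM d L mv kk hL) (L ^ r * L ^ kk)) - qvAdjKer (cvM d L mv kk hL) (L ^ r * L ^ kk) W' ∘ₗ qvKer (cvM d L mv kk hL) (L ^ r * L ^ kk) W')) ∘ₗ
        mulOp ((fun p : CvX d L mv kk hL × ι => χ p.1) ∘ liftMap (kingPrV L kk r (cvM d L mv kk hL)) ι) := by
    have e1 : ((fun p : CvX d L mv kk hL × ι => χ p.1) ∘ liftMap (kingPrV L kk r (cvM d L mv kk hL)) ι) = fun q : CvX' d L mv kk r hL × ι => (fun x' => χ (kingPrV L kk r (cvM d L mv kk hL) x')) q.1 := rfl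
    rw [e1, show cvNVq' d L mv kk r hL a ι e U' = a • (tensorId ι (qvAdjRe (cvM d L mv kk hL) (L ^ r * L ^ kk) ∘ₗ qvRe (cvM d L mv kk hL) (L ^ r * L ^ kk)) -
        qvAdjKer (cvM d L mv kk hL) (L ^ r * L ^ kk) (cvaPath (cvM d L mv kk hL) (L ^ r * L ^ kk) (cvT e U')) ∘ₗ qvKer (cvM d L mv kk hL) (L ^ r * L ^ kk) (cvaPath (cvM d L mv kk hL) (L ^ r * L ^ kk) (cvT e U'))) from rfl,
      LinearMap.smul_comp, LinearMap.smul_comp, LinearMap.sub_comp, LinearMap.sub_comp,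
      CovAvg.adjKer_comp_ker_comp_mulOp_congr_of_blocks (cvM d L mv kk hL) (L ^ r * L ^ kk) hχS' hnearW']
  -- (7) assemble
  have hc0 : 0 ≤ B4Sect5Proof.latticeConst (d + 1) δ := B4Sect5Proof.latticeConst_nonneg (d + 1) hδ.le
  rw [hfine, hcoarse, idef_sandwich_pull]
  exact hasMaj_sandwich₂_of_abs_le_one (g := unitTorusGeo L kk (cvM d L mv kk hL)) (liftBlk (cvBlk d L mv kk hL) ι) (liftBlk (cvBlk d L mv kk hL ∘ kingPrV L kk r (cvM d L mv kk hL)) ι)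
    (ψ' := (fun p : CvX d L mv kk hL × ι => f p.1) ∘ liftMap (kingPrV L kk r (cvM d L mv kk hL)) ι) (χ := fun p : CvX d L mv kk hL × ι => χ p.1)
    (fun p => hf _) (fun p => hχ p.1) (fun y y' => by rw [unitTorusGeo_dist]; positivity)
    (h325.mono fun y y' => by rw [unitTorusGeo_dist, hKdef, hK'def]; apply le_of_eq; ring)

end Rows

end Summit.QuantumFields.YangMills.BalabanUVNodes.N15.Gluing

end
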